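import Mathlib.RingTheory.PowerSeries.Order
import Mathlib.Tactic.NormNum
import Mathlib.Tactic.Ring
import HarnessLib

/-!
# The parity obstruction behind a Type R failure of the weak semiregularity criterion

Family `hodge`, layer `Literature/AlgebraicGeometry/HodgeTheory`. Companion to `SemiregularityWeakCriterion.lean` (Markman's weak criterion (W),
[`Markman2025SecantWeilSurvey`, Question 11.4]) and to the ladder note `papers/HodgeConjecture/hodge-weil-ladder`, section "Q 11.4 at order two"
(Proposition R). There, for a Calabi–Yau threefold `Y₀` containing a `(0,−2)`-curve `C` of width 2 (transversal model `xy = z² − w⁴`), the relative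
Hilbert scheme of `C` over an arc `t ↦ Y_t` in `Def(Y₀)` is `{w² + a₀(t) = 0}`; the weak criterion (W) for `𝒪_C` says `a₀ ∈ 𝔪²`, and the sheaf
`𝒪_C` extends over the arc (the conclusion of the Semi-regularity Theorem 2.1 of the survey) iff `w(t)² = −a₀(t)` has a solution `w ∈ ℂ[[t]]`.
An order-3 automorphism acting without invariants on `H^{2,1}(Y₀)` and trivially on the local parameter forces `a₀(t) ∈ ℂ[[t³]]`, so the first
possible splitting order is 3. The present file proves the formal-power-series facts that decide the matter: a power series whose square is a
monomial of odd degree does not exist (`no_powerSeries_sq_eq_odd_monomial`), in particular `w² = −c·t³`, `c ≠ 0`, has no solution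
(`typeR_order_three`), while after the base change `t = s²` the series `w = b·s³` (`b² = −c`) is a solution (`typeR_after_base_change`) — so such
a configuration is a counterexample to Question 11.4 exactly as stated (extension over no neighbourhood of `0`, but over a ramified double
cover). Pure algebra over a field; no geometry is formalised here.
-/

namespace Literature.AlgebraicGeometry.HodgeTheory

open PowerSeries

/-- Over a field, `order (w²) = 2·order w` is even or `⊤`, so `w²` is never a monomial of odd degree with non-zero coefficient. [folklore] -/
theorem no_powerSeries_sq_eq_odd_monomial {K : Type*} [Field K] (c : K) (hc : c ≠ 0) (n : ℕ) (w : K⟦X⟧)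
    (h : w ^ 2 = monomial (2 * n + 1) c) : False := by
  have h1 : (w ^ 2).order = ((2 * n + 1 : ℕ) : ℕ∞) := by
    rw [h, order_monomial_of_ne_zero _ _ hc]
  rw [order_pow, two_nsmul] at h1
  by_cases htop : w.order = ⊤
  · rw [htop] at h1
    have h2 : (⊤ : ℕ∞) = ((2 * n + 1 : ℕ) : ℕ∞) := by simpa using h1
    exact ENat.top_ne_coe _ h2
  · obtain ⟨m, hm⟩ := ENat.ne_top_iff_exists.mp htop
    rw [← hm] at h1
    norm_cast at h1
    omega

/-- The Type R witness of Proposition R: `w² = −c·t³` (`c ≠ 0`, i.e. the double curve splits at order exactly 3) has no solution in `K[[t]]` —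
the sheaf `𝒪_C` does not extend over any neighbourhood of `0` in the arc. [folklore] -/
theorem typeR_order_three {K : Type*} [Field K] (c : K) (hc : c ≠ 0) :
    ¬ ∃ w : K⟦X⟧, w ^ 2 = -(monomial 3 c) := by
  rintro ⟨w, hw⟩
  have : w ^ 2 = monomial (2 * 1 + 1) (-c) := by
    rw [hw]; simp
  exact no_powerSeries_sq_eq_odd_monomial (-c) (neg_ne_zero.mpr hc) 1 w this

/-- … whereas after the base change `t = s²` (so that `−c·t³` becomes `−c·s⁶`) a square root `b` of `−c` gives the solution `w = b·s³`:
`(b·s³)² = b²·s⁶`. Over `ℂ` such `b` exists, so the extension exists over the ramified double cover — Type R, not Type S. [folklore] -/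
theorem typeR_after_base_change {K : Type*} [Field K] (b : K) :
    (monomial 3 b : K⟦X⟧) ^ 2 = monomial 6 (b ^ 2) := by
  rw [sq, sq, monomial_mul_monomial]

/-- The (W)-compatible but harmless case of Proposition R (local weight `ζ²` on `a₀`): splitting at order 2, `−a₀ = b²t² + …`; at leading order
`w = b·t` solves `w² = b²t²`. [folklore] -/
theorem order_two_extends {K : Type*} [Field K] (b : K) :
    (monomial 1 b : K⟦X⟧) ^ 2 = monomial 2 (b ^ 2) := by
  rw [sq, sq, monomial_mul_monomial]

end Literature.AlgebraicGeometry.HodgeTheory
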